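import Literature.LinearAlgebra.Matrix.Berkowitz
import Mathlib.LinearAlgebra.Matrix.AbsoluteValue
import Mathlib.Data.ZMod.Basic
import Mathlib.Data.List.GetD
import Mathlib.Algebra.Order.Interval.Finset.SuccPred
import HarnessLib

/-!
# Berkowitz's division-free determinant as a functional program on lists; the integer determinant modulo `4^k`

Topic `Literature/LinearAlgebra/Matrix`; sequel of `Berkowitz.lean` (Samuelson's identity and
Berkowitz's coefficient recursion `charpoly_coeff_eq_berkowitz`, over any commutative ring). This
file turns the recursion into the textbook ALGORITHM (Berkowitz 1984; Soltys 2002, §2, Def. 2: the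
characteristic polynomial of the leading `(r+1) × (r+1)` block from that of the leading `r × r`
block `M`, the border row `R`, column `S`, corner `a`, and the products `R Mᵗ S`), written as a
total functional program on matrices given as LISTS OF ROWS — the form in which a polynomial-time
string function (`Literature/Computability/Complexity/CodeFP.lean`) runs it — and proves it correct:

* `RingOps α` — a bare record of ring operations (`zero, one, add, mul, sub`), so that ONE program
  text serves both the mathematics (`RingOps.ofRing R`, any commutative ring) and the machine
  (`RingOps.modSucc N`: arithmetic on natural numbers modulo `N + 1`, every value reduced, so that all
  intermediate numbers have at most `|bin N|` bits); `RingOps.IsHom` and `RingOps.isHom_modSucc`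
  (reduction modulo `N + 1` is a homomorphism onto `ZMod (N + 1)`).
* The program (namespace `Berkowitz`): `dot`, `matVec`, `powSeq` (the numbers `R Mᵗ S`, `t < r`, by
  iterated matrix–vector products), `newCoeff`/`step` (one row of Berkowitz's Toeplitz recursion),
  `charpolyCoeffs` (the coefficient list `[c₀, …, cₙ]` of `χ_A`), `det` (`= (-1)ⁿ c₀`).
* Functoriality: `Berkowitz.map_det` etc. — a homomorphism of bare operations commutes with the
  whole program (so the machine's run modulo `N + 1` is the image of the run over `ZMod (N + 1)`).
* **Correctness over a commutative ring**: `Berkowitz.charpolyCoeffs_rows`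
  (`charpolyCoeffs (ofRing R) (rows A) = [χ_A.coeff 0, …, χ_A.coeff n]`, by induction on the
  leading blocks with `charpoly_coeff_eq_berkowitz`) and `Berkowitz.det_rows`
  (`det (ofRing R) (rows A) = A.det`, with Mathlib's `Matrix.det_eq_sign_charpoly_coeff`).
* **The integer determinant by modular arithmetic**: `Berkowitz.intDet N A` runs the program modulo
  `N + 1` on the reduced entries and lifts the result to the balanced residue; `Berkowitz.intDet_rows`:
  it equals `A.det` as soon as `2 · n! · Tⁿ ≤ N` for a bound `T` on the entries (Hadamard-type bound
  `Matrix.det_le`). This is the division-free, size-controlled route to integer determinants (and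
  hence to Cramer membership tests and Gram-determinant independence tests) for machine-level
  complexity statements; no Gaussian elimination, no fractions.

## References

* [Berkowitz1984] S. J. Berkowitz, *On computing the determinant in small parallel time using a
  small number of processors*, Inform. Process. Lett. 18 (1984) 147–150 (the algorithm).
* [Soltys2002] M. Soltys, *Berkowitz's algorithm and clow sequences*, Electron. J. Linear Algebra 9
  (2002) 42–54, §2, Def. 2 (the recursion as an algorithm on the leading principal blocks).
* J. von zur Gathen, J. Gerhard, *Modern Computer Algebra*, 3rd ed., CUP 2013, §5.5 (modular
  determinant computation: compute `det A mod m` for `m` exceeding twice the Hadamard bound and take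
  the balanced residue) — the lifting step; everything is proved here, the citation locates the method.
-/

namespace Literature.LinearAlgebra.Matrix

open _root_.Matrix Finset

/-! ### Bare ring operations and their homomorphisms -/

/-- A bare record of ring operations on a type (no laws): the signature the Berkowitz program is
written against, instantiated by genuine rings (`RingOps.ofRing`) and by modular machine arithmetic
on `ℕ` (`RingOps.modSucc`). [folklore] -/
structure RingOps (α : Type*) where
  /-- `0` -/
  zero : α
  /-- `1` -/
  one : α
  /-- addition -/
  add : α → α → α
  /-- multiplication -/
  mul : α → α → α
  /-- subtraction -/
  sub : α → α → α

namespace RingOps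

/-- The operations of a commutative ring. [folklore] -/
def ofRing (R : Type*) [CommRing R] : RingOps R := ⟨0, 1, (· + ·), (· * ·), (· - ·)⟩

/-- **Machine arithmetic modulo `N + 1`** on natural numbers: every operation returns the reduced
representative `< N + 1` (subtraction as `a + ((N+1) - b mod (N+1))`). [folklore] -/
def modSucc (N : ℕ) : RingOps ℕ :=
  ⟨0, 1 % (N + 1), fun a b => (a + b) % (N + 1), fun a b => (a * b) % (N + 1),
    fun a b => (a + (N + 1 - b % (N + 1))) % (N + 1)⟩

/-- Unfolding of `ofRing`. [folklore] -/
@[simp] theorem ofRing_zero (R : Type*) [CommRing R] : (ofRing R).zero = 0 := rfl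
/-- Unfolding of `ofRing`. [folklore] -/
@[simp] theorem ofRing_one (R : Type*) [CommRing R] : (ofRing R).one = 1 := rfl
/-- Unfolding of `ofRing`. [folklore] -/
@[simp] theorem ofRing_add (R : Type*) [CommRing R] (a b : R) : (ofRing R).add a b = a + b := rfl
/-- Unfolding of `ofRing`. [folklore] -/
@[simp] theorem ofRing_mul (R : Type*) [CommRing R] (a b : R) : (ofRing R).mul a b = a * b := rfl
/-- Unfolding of `ofRing`. [folklore] -/
@[simp] theorem ofRing_sub (R : Type*) [CommRing R] (a b : R) : (ofRing R).sub a b = a - b := rfl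

/-- A map commuting with the bare operations. [folklore] -/
structure IsHom {α β : Type*} (o : RingOps α) (o' : RingOps β) (φ : α → β) : Prop where
  /-- preserves `0` -/
  zero : φ o.zero = o'.zero
  /-- preserves `1` -/
  one : φ o.one = o'.one
  /-- preserves `+` -/
  add : ∀ a b, φ (o.add a b) = o'.add (φ a) (φ b)
  /-- preserves `*` -/
  mul : ∀ a b, φ (o.mul a b) = o'.mul (φ a) (φ b)
  /-- preserves `-` -/
  sub : ∀ a b, φ (o.sub a b) = o'.sub (φ a) (φ b)

/-- Every value of the modular operations is reduced: `< N + 1`. [folklore] -/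
theorem modSucc_one_lt (N : ℕ) : (modSucc N).one < N + 1 := Nat.mod_lt _ N.succ_pos

/-- Every value of the modular operations is reduced: `< N + 1`. [folklore] -/
theorem modSucc_sub_lt (N a b : ℕ) : (modSucc N).sub a b < N + 1 := Nat.mod_lt _ N.succ_pos

/-- **Reduction modulo `N + 1` is a homomorphism** from the machine arithmetic `modSucc N` onto
`ZMod (N + 1)`. [folklore] -/
theorem isHom_modSucc (N : ℕ) :
    IsHom (modSucc N) (ofRing (ZMod (N + 1))) (fun a : ℕ => (a : ZMod (N + 1))) where
  zero := Nat.cast_zero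
  one := by
    change (((1 % (N + 1) : ℕ)) : ZMod (N + 1)) = 1
    rw [ZMod.natCast_mod, Nat.cast_one]
  add a b := by
    change (((a + b) % (N + 1) : ℕ) : ZMod (N + 1)) = (a : ZMod (N + 1)) + b
    rw [ZMod.natCast_mod, Nat.cast_add]
  mul a b := by
    change (((a * b) % (N + 1) : ℕ) : ZMod (N + 1)) = (a : ZMod (N + 1)) * b
    rw [ZMod.natCast_mod, Nat.cast_mul]
  sub a b := by
    change (((a + (N + 1 - b % (N + 1))) % (N + 1) : ℕ) : ZMod (N + 1)) = (a : ZMod (N + 1)) - b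
    rw [ZMod.natCast_mod, Nat.cast_add, Nat.cast_sub (Nat.mod_lt _ N.succ_pos).le, ZMod.natCast_mod,
      ZMod.natCast_self]
    ring

end RingOps

/-! ### The program -/

namespace Berkowitz

variable {α β : Type*} (o : RingOps α)

/-- Dot product of two lists (the shorter truncates the longer), accumulated from the left.
[folklore] -/
def dot (u v : List α) : α := (List.zipWith o.mul u v).foldl o.add o.zero

/-- Matrix–vector product, the matrix given as its list of rows. [folklore] -/
def matVec (M : List (List α)) (v : List α) : List α := M.map fun row => dot o row v

/-- One step of the power sequence: `(s, q) ↦ (M s, q ++ [R · s])`. [cite: Soltys2002, §2 Def. 2] -/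
def powStep (M : List (List α)) (R : List α) (p : List α × List α) (_u : Unit) : List α × List α :=
  (matVec o M p.1, p.2 ++ [dot o R p.1])

/-- **The Berkowitz numbers** `[R S, R M S, …, R M^{r-1} S]` by `r` iterated matrix–vector products.
[cite: Soltys2002, §2 Def. 2] -/
def powSeq (M : List (List α)) (R S : List α) (r : ℕ) : List α :=
  ((List.replicate r ()).foldl (powStep o M R) (S, [])).2

/-- One row of Berkowitz's Toeplitz recursion: from the coefficient list `c` of `χ_M`, the numbers
`q = [R Mᵗ S]ₜ` and the corner `a`, the coefficient of `X^l` in `χ_A`: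
`c_{l-1} − a c_l − ∑_{t} c_{l+1+t} qₜ`. [cite: Soltys2002, §2 Def. 2] [cite: Berkowitz1984, §2] -/
def newCoeff (c q : List α) (a : α) (l : ℕ) : α :=
  o.sub (o.sub (if l = 0 then o.zero else c.getD (l - 1) o.zero) (o.mul a (c.getD l o.zero)))
    (dot o (c.drop (l + 1)) q)

/-- The power sequence attached to the leading `(r+1) × (r+1)` block of `A`: `M` = leading
`r × r` block, `R` = row `r` cut to `r` entries, `S` = column `r` cut to `r` entries.
[cite: Soltys2002, §2 Def. 2] -/
def blockPowSeq (A : List (List α)) (r : ℕ) : List α :=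
  powSeq o ((A.take r).map (·.take r)) ((A.getD r []).take r) ((A.take r).map (·.getD r o.zero)) r

/-- **One step of Berkowitz's algorithm**: the coefficient list (length `r + 2`) of the
characteristic polynomial of the leading `(r+1) × (r+1)` block from that (length `r + 1`) of the
leading `r × r` block. [cite: Soltys2002, §2 Def. 2] [cite: Berkowitz1984, §2] -/
def step (A : List (List α)) (c : List α) (r : ℕ) : List α :=
  (List.range (r + 2)).map (newCoeff o c (blockPowSeq o A r) ((A.getD r []).getD r o.zero))

/-- The step with its counter, as folded over a list of units. [folklore] -/
def coeffStep (A : List (List α)) (p : ℕ × List α) (_u : Unit) : ℕ × List α := (p.1 + 1, step o A p.2 p.1)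

/-- **Berkowitz's algorithm**: the coefficient list `[c₀, c₁, …, cₙ]` of the characteristic
polynomial of the `n × n` matrix with rows `A` (`n = |A|`), by `n` steps from `χ = 1`.
[cite: Berkowitz1984, §2] [cite: Soltys2002, §2 Def. 2] -/
def charpolyCoeffs (A : List (List α)) : List α :=
  ((List.replicate A.length ()).foldl (coeffStep o A) (0, [o.one])).2

/-- **The determinant**, `(-1)ⁿ c₀`. [cite: Berkowitz1984, §2] -/
def det (A : List (List α)) : α :=
  if A.length % 2 = 0 then (charpolyCoeffs o A).getD 0 o.zero
  else o.sub o.zero ((charpolyCoeffs o A).getD 0 o.zero)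

/-! ### Functoriality in the operations -/

section Hom

variable {o} {o' : RingOps β} {φ : α → β} (hφ : RingOps.IsHom o o' φ)
include hφ

/-- Homomorphisms commute with left folds of `add`. [folklore] -/
theorem foldl_add_map (l : List α) (a : α) :
    φ (l.foldl o.add a) = (l.map φ).foldl o'.add (φ a) := by
  induction l generalizing a with
  | nil => rfl
  | cons x l ih => simp only [List.foldl_cons, List.map_cons, ih, hφ.add]

/-- Homomorphisms commute with pointwise `mul`. [folklore] -/
theorem zipWith_mul_map (u v : List α) :
    (List.zipWith o.mul u v).map φ = List.zipWith o'.mul (u.map φ) (v.map φ) := by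
  induction u generalizing v with
  | nil => simp
  | cons a u ih =>
    cases v with
    | nil => simp
    | cons b v => simp [ih, hφ.mul]

/-- Homomorphisms commute with `dot`. [folklore] -/
theorem map_dot (u v : List α) : φ (dot o u v) = dot o' (u.map φ) (v.map φ) := by
  rw [dot, dot, foldl_add_map hφ, zipWith_mul_map hφ, hφ.zero]

/-- Homomorphisms commute with `matVec`. [folklore] -/
theorem map_matVec (M : List (List α)) (v : List α) :
    (matVec o M v).map φ = matVec o' (M.map (·.map φ)) (v.map φ) := by
  simp only [matVec, List.map_map]
  congr 1
  funext row
  exact map_dot hφ row v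

/-- Homomorphisms commute with the power fold. [folklore] -/
theorem map_powStep_foldl (M : List (List α)) (R : List α) (k : ℕ) (p : List α × List α) :
    Prod.map (·.map φ) (·.map φ) ((List.replicate k ()).foldl (powStep o M R) p) =
      (List.replicate k ()).foldl (powStep o' (M.map (·.map φ)) (R.map φ))
        (Prod.map (·.map φ) (·.map φ) p) := by
  induction k generalizing p with
  | zero => rfl
  | succ k ih =>
    obtain ⟨s, q⟩ := p
    rw [List.replicate_succ, List.foldl_cons, List.foldl_cons, ih]
    congr 1
    simp only [powStep, Prod.map_apply, List.map_append, List.map_cons, List.map_nil,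
      map_matVec hφ, map_dot hφ]

/-- Homomorphisms commute with `powSeq`. [folklore] -/
theorem map_powSeq (M : List (List α)) (R S : List α) (r : ℕ) :
    (powSeq o M R S r).map φ = powSeq o' (M.map (·.map φ)) (R.map φ) (S.map φ) r := by
  have h := congrArg Prod.snd (map_powStep_foldl hφ M R r (S, []))
  simpa [powSeq] using h

/-- Homomorphisms commute with `newCoeff`. [folklore] -/
theorem map_newCoeff (c q : List α) (a : α) (l : ℕ) :
    φ (newCoeff o c q a l) = newCoeff o' (c.map φ) (q.map φ) (φ a) l := by
  simp only [newCoeff, hφ.sub, hφ.mul, map_dot hφ, List.map_drop]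
  congr 2
  split_ifs
  · exact hφ.zero
  · rw [← hφ.zero, List.getD_map]
  · rw [← hφ.zero, List.getD_map]

/-- Homomorphisms commute with `blockPowSeq`. [folklore] -/
theorem map_blockPowSeq (A : List (List α)) (r : ℕ) :
    (blockPowSeq o A r).map φ = blockPowSeq o' (A.map (·.map φ)) r := by
  have h1 : ((A.take r).map (·.take r)).map (·.map φ) = ((A.map (·.map φ)).take r).map (·.take r) := by
    simp only [List.map_take, List.map_map, Function.comp_def]
  have h2 : ((A.getD r []).take r).map φ = ((A.map (·.map φ)).getD r []).take r := by
    rw [show ([] : List β) = ([] : List α).map φ from rfl, List.getD_map, List.map_take]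
  have h3 : ((A.take r).map (·.getD r o.zero)).map φ = ((A.map (·.map φ)).take r).map (·.getD r o'.zero) := by
    simp only [List.map_take, List.map_map, Function.comp_def, ← hφ.zero, List.getD_map]
  rw [blockPowSeq, blockPowSeq, map_powSeq hφ, h1, h2, h3]

/-- Homomorphisms commute with `step`. [folklore] -/
theorem map_step (A : List (List α)) (c : List α) (r : ℕ) :
    (step o A c r).map φ = step o' (A.map (·.map φ)) (c.map φ) r := by
  have ha : φ ((A.getD r []).getD r o.zero) = ((A.map (·.map φ)).getD r []).getD r o'.zero := by
    rw [show ([] : List β) = ([] : List α).map φ from rfl, List.getD_map, ← hφ.zero, List.getD_map]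
  simp only [step, List.map_map]
  congr 1
  funext l
  rw [Function.comp_apply, map_newCoeff hφ, map_blockPowSeq hφ, ha]

/-- Homomorphisms commute with the coefficient fold. [folklore] -/
theorem map_coeffStep_foldl (A : List (List α)) (k : ℕ) (p : ℕ × List α) :
    Prod.map id (·.map φ) ((List.replicate k ()).foldl (coeffStep o A) p) =
      (List.replicate k ()).foldl (coeffStep o' (A.map (·.map φ))) (Prod.map id (·.map φ) p) := by
  induction k generalizing p with
  | zero => rfl
  | succ k ih =>
    obtain ⟨t, c⟩ := p
    rw [List.replicate_succ, List.foldl_cons, List.foldl_cons, ih]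
    congr 1
    simp only [coeffStep, Prod.map_apply, id, map_step hφ]

/-- Homomorphisms commute with `charpolyCoeffs`. [folklore] -/
theorem map_charpolyCoeffs (A : List (List α)) :
    (charpolyCoeffs o A).map φ = charpolyCoeffs o' (A.map (·.map φ)) := by
  have h := congrArg Prod.snd (map_coeffStep_foldl hφ A A.length (0, [o.one]))
  simpa [charpolyCoeffs, hφ.one] using h

/-- **Homomorphisms commute with the whole program**: `φ (det o A) = det o' (φ ∘∘ A)`. [folklore] -/
theorem map_det (A : List (List α)) : φ (det o A) = det o' (A.map (·.map φ)) := by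
  have h0 : φ ((charpolyCoeffs o A).getD 0 o.zero) =
      (charpolyCoeffs o' (A.map (·.map φ))).getD 0 o'.zero := by
    rw [← hφ.zero, ← List.getD_map (f := φ), map_charpolyCoeffs hφ]
  simp only [det, List.length_map]
  split_ifs
  · exact h0
  · rw [hφ.sub, hφ.zero, h0]

end Hom

/-! ### List bookkeeping -/

section Lists

variable {R : Type*}

/-- The list of rows of a matrix. [folklore] -/
def rows {n m : ℕ} (A : Matrix (Fin n) (Fin m) R) : List (List R) := List.ofFn fun i => List.ofFn (A i)

/-- A matrix with `n` rows has a row list of length `n`. [folklore] -/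
@[simp] theorem length_rows {n m : ℕ} (A : Matrix (Fin n) (Fin m) R) : (rows A).length = n := by
  simp [rows]

/-- Indexing `List.ofFn` with a default. [folklore] -/
theorem getD_ofFn {n : ℕ} (f : Fin n → R) (d : R) (i : ℕ) :
    (List.ofFn f).getD i d = if h : i < n then f ⟨i, h⟩ else d := by
  split_ifs with h
  · rw [List.getD_eq_getElem _ _ (by simpa using h), List.getElem_ofFn]
  · exact List.getD_eq_default _ _ (by simpa using Nat.le_of_not_lt h)

/-- A prefix of `List.ofFn` is `List.ofFn` of the restriction. [folklore] -/
theorem take_ofFn {n : ℕ} (f : Fin n → R) {r : ℕ} (h : r ≤ n) :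
    (List.ofFn f).take r = List.ofFn fun i : Fin r => f (Fin.castLE h i) := by
  refine List.ext_getElem (by simp [h]) fun i h₁ h₂ => ?_
  rw [List.getElem_take, List.getElem_ofFn, List.getElem_ofFn]
  rfl

/-- `zipWith` of two `List.ofFn` of the same length. [folklore] -/
theorem zipWith_ofFn {γ δ : Type*} {n : ℕ} (f : R → γ → δ) (u : Fin n → R) (v : Fin n → γ) :
    List.zipWith f (List.ofFn u) (List.ofFn v) = List.ofFn fun i => f (u i) (v i) := by
  refine List.ext_getElem (by simp) fun i h₁ h₂ => ?_
  rw [List.getElem_zipWith, List.getElem_ofFn, List.getElem_ofFn, List.getElem_ofFn]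

/-- Row `r` of the row list. [folklore] -/
theorem rows_getD {n m : ℕ} (A : Matrix (Fin n) (Fin m) R) {r : ℕ} (hr : r < n) :
    (rows A).getD r [] = List.ofFn (A ⟨r, hr⟩) := by
  rw [rows, getD_ofFn, dif_pos hr]

variable {n : ℕ} (A : Matrix (Fin n) (Fin n) R)

/-- The leading `r × r` block. [cite: Soltys2002, §2 Def. 2] -/
def block {r : ℕ} (h : r ≤ n) : Matrix (Fin r) (Fin r) R := A.submatrix (Fin.castLE h) (Fin.castLE h)

/-- The leading `r × r` block of the leading `(r+1) × (r+1)` block. [folklore] -/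
theorem block_succ_submatrix {r : ℕ} (h : r + 1 ≤ n) :
    (block A h).submatrix Fin.castSucc Fin.castSucc = block A (Nat.le_of_succ_le h) := by
  ext i j; rfl

/-- The program's `M`: the first `r` rows cut to `r` entries are the rows of the leading block. [folklore] -/
theorem rows_take_map_take {r : ℕ} (h : r ≤ n) :
    ((rows A).take r).map (·.take r) = rows (block A h) := by
  rw [rows, take_ofFn _ h, List.map_ofFn]
  simp only [rows, block, Function.comp_def, take_ofFn _ h]
  rfl

/-- Row `r` of the row list. [folklore] -/
theorem rows_getD_take {r : ℕ} (h : r + 1 ≤ n) :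
    ((rows A).getD r []).take r = List.ofFn fun j : Fin r => block A h (Fin.last r) (Fin.castSucc j) := by
  rw [rows_getD A (by omega), take_ofFn _ (by omega)]
  rfl

/-- The program's `S`: entry `r` of the first `r` rows is the border column of the leading `(r+1) × (r+1)` block. [folklore] -/
theorem rows_take_map_getD [Zero R] {r : ℕ} (h : r + 1 ≤ n) :
    ((rows A).take r).map (·.getD r (0 : R)) =
      List.ofFn fun i : Fin r => block A h (Fin.castSucc i) (Fin.last r) := by
  rw [rows, take_ofFn _ (Nat.le_of_succ_le h), List.map_ofFn]
  congr 1
  funext i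
  rw [Function.comp_apply, getD_ofFn, dif_pos (by omega)]
  rfl

/-- Row `r` of the row list. [folklore] -/
theorem rows_getD_getD [Zero R] {r : ℕ} (h : r + 1 ≤ n) :
    ((rows A).getD r []).getD r (0 : R) = block A h (Fin.last r) (Fin.last r) := by
  rw [rows_getD A (by omega), getD_ofFn, dif_pos (by omega)]
  rfl

end Lists

/-! ### Correctness over a commutative ring -/

section Ring

variable {R : Type*} [CommRing R]

/-- `dot` over a ring is the sum of the products. [folklore] -/
theorem dot_ofRing (u v : List R) : dot (RingOps.ofRing R) u v = (List.zipWith (· * ·) u v).sum := by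
  rw [dot, List.sum_eq_foldl]
  rfl

/-- `dot` of two vectors of the same length is the dot product. [folklore] -/
theorem dot_ofFn {r : ℕ} (u v : Fin r → R) :
    dot (RingOps.ofRing R) (List.ofFn u) (List.ofFn v) = ∑ i, u i * v i := by
  rw [dot_ofRing, zipWith_ofFn, List.sum_ofFn]

/-- `dot` against a longer list: only the common indices count. [folklore] -/
theorem dot_ofFn_drop {r l : ℕ} (c : Fin (r + 1) → R) (q : Fin r → R) :
    dot (RingOps.ofRing R) ((List.ofFn c).drop (l + 1)) (List.ofFn q) =
      ∑ t ∈ range (r - l), (List.ofFn c).getD (l + 1 + t) 0 * (List.ofFn q).getD t 0 := by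
  rw [dot_ofRing]
  have key : ∀ (u : List R) (w : List R) (k : ℕ), u.length = k → k ≤ w.length →
      (List.zipWith (· * ·) u w).sum = ∑ t ∈ range k, u.getD t 0 * w.getD t 0 := by
    intro u
    induction u with
    | nil => intro w k hk _; simp only [List.length_nil] at hk; subst hk; simp
    | cons a u ih =>
      intro w k hk hkw
      cases w with
      | nil => simp only [List.length_nil, Nat.le_zero] at hkw; subst hkw; simp at hk
      | cons b w =>
        cases k with
        | zero => simp at hk
        | succ k =>
          simp only [List.length_cons, Nat.add_right_cancel_iff, Nat.succ_le_succ_iff] at hk hkw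
          rw [List.zipWith_cons_cons, List.sum_cons, Finset.sum_range_succ', ih w k hk hkw]
          simp only [List.getD_cons_succ, List.getD_cons_zero]
          ring
  rw [key _ _ (r - l) (by simp) (by simp)]
  refine Finset.sum_congr rfl fun t _ => ?_
  simp only [List.getD_eq_getElem?_getD, List.getElem?_drop]

/-- `matVec` over a ring is `Matrix.mulVec`. [folklore] -/
theorem matVec_rows {r : ℕ} (M : Matrix (Fin r) (Fin r) R) (v : Fin r → R) :
    matVec (RingOps.ofRing R) (rows M) (List.ofFn v) = List.ofFn (M *ᵥ v) := by
  simp only [matVec, rows, List.map_ofFn]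
  congr 1
  funext i
  rw [Function.comp_apply, dot_ofFn]
  rfl

/-- The power fold computes the iterates `Mᵗ S` and the numbers `R Mᵗ S`. [cite: Soltys2002, §2 Def. 2] -/
theorem powStep_foldl_rows {r : ℕ} (M : Matrix (Fin r) (Fin r) R) (Rv S : Fin r → R) (k : ℕ)
    (q : List R) :
    (List.replicate k ()).foldl (powStep (RingOps.ofRing R) (rows M) (List.ofFn Rv)) (List.ofFn S, q) =
      (List.ofFn ((M ^ k) *ᵥ S), q ++ (List.range k).map fun t => ∑ j, Rv j * ((M ^ t) *ᵥ S) j) := by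
  induction k generalizing S q with
  | zero => simp
  | succ k ih =>
    rw [List.replicate_succ, List.foldl_cons]
    have h1 : powStep (RingOps.ofRing R) (rows M) (List.ofFn Rv) (List.ofFn S, q) () =
        (List.ofFn (M *ᵥ S), q ++ [∑ j, Rv j * S j]) := by
      simp only [powStep, matVec_rows, dot_ofFn]
    rw [h1, ih (M *ᵥ S) (q ++ [∑ j, Rv j * S j])]
    simp only [Matrix.mulVec_mulVec, ← pow_succ, List.append_assoc, List.singleton_append,
      List.range_succ_eq_map, List.map_cons, List.map_map, Function.comp_def, pow_zero,
      Matrix.one_mulVec, Nat.succ_eq_add_one]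

/-- **The Berkowitz numbers**: `powSeq` over a ring lists `∑ⱼ ∑ᵢ Rⱼ (Mᵗ)ⱼᵢ Sᵢ`, `t < r`.
[cite: Soltys2002, §2 Def. 2] -/
theorem powSeq_rows {r : ℕ} (M : Matrix (Fin r) (Fin r) R) (Rv S : Fin r → R) :
    powSeq (RingOps.ofRing R) (rows M) (List.ofFn Rv) (List.ofFn S) r =
      List.ofFn fun t : Fin r => ∑ j, ∑ i, Rv j * (M ^ (t : ℕ)) j i * S i := by
  rw [powSeq, powStep_foldl_rows, List.nil_append]
  refine List.ext_getElem (by simp) fun t h₁ h₂ => ?_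
  rw [List.getElem_map, List.getElem_range, List.getElem_ofFn]
  refine Finset.sum_congr rfl fun j _ => ?_
  rw [Matrix.mulVec, dotProduct, Finset.mul_sum]
  exact Finset.sum_congr rfl fun i _ => by ring

variable {n : ℕ} (A : Matrix (Fin n) (Fin n) R)

/-- The coefficient list of the characteristic polynomial of the leading `r × r` block.
[cite: Soltys2002, §2 Def. 2] -/
noncomputable def coeffList {r : ℕ} (h : r ≤ n) : List R := List.ofFn fun l : Fin (r + 1) => (block A h).charpoly.coeff l

/-- Indexing the coefficient list with default `0` gives the coefficients (also beyond the degree). [folklore] -/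
theorem coeffList_getD {r : ℕ} (h : r ≤ n) (k : ℕ) :
    (coeffList A h).getD k 0 = (block A h).charpoly.coeff k := by
  rw [coeffList, getD_ofFn]
  split_ifs with hk
  · rfl
  · nontriviality R
    symm
    apply Polynomial.coeff_eq_zero_of_natDegree_lt
    rw [Matrix.charpoly_natDegree_eq_dim, Fintype.card_fin]
    omega

/-- **One step is one row of Berkowitz's recursion** (`charpoly_coeff_eq_berkowitz`).
[cite: Soltys2002, §2 Def. 2] [cite: Berkowitz1984, §2] -/
theorem step_coeffList {r : ℕ} (h : r + 1 ≤ n) :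
    step (RingOps.ofRing R) (rows A) (coeffList A (Nat.le_of_succ_le h)) r = coeffList A h := by
  set q : Fin r → R := fun t => ∑ j, ∑ i, block A h (Fin.last r) (Fin.castSucc j) *
      (block A (Nat.le_of_succ_le h) ^ (t : ℕ)) j i * block A h (Fin.castSucc i) (Fin.last r) with hqdef
  have hq : blockPowSeq (RingOps.ofRing R) (rows A) r = List.ofFn q := by
    rw [blockPowSeq, rows_take_map_take A (Nat.le_of_succ_le h), rows_getD_take A h,
      show (RingOps.ofRing R).zero = (0 : R) from rfl, rows_take_map_getD A h, powSeq_rows]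
  have ha : ((rows A).getD r []).getD r (RingOps.ofRing R).zero = block A h (Fin.last r) (Fin.last r) :=
    rows_getD_getD A h
  refine List.ext_getElem (by simp [step, coeffList]) fun l h₁ h₂ => ?_
  have hl : l < r + 2 := by simpa [step] using h₁
  rw [← List.getD_eq_getElem _ 0 h₁, ← List.getD_eq_getElem _ 0 h₂, coeffList_getD]
  have hstep : (step (RingOps.ofRing R) (rows A) (coeffList A (Nat.le_of_succ_le h)) r).getD l 0 =
      newCoeff (RingOps.ofRing R) (coeffList A (Nat.le_of_succ_le h)) (List.ofFn q)
        (block A h (Fin.last r) (Fin.last r)) l := by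
    rw [step, hq, ha, List.getD_eq_getElem?_getD, List.getElem?_map, List.getElem?_range hl]
    rfl
  rw [hstep, charpoly_coeff_eq_berkowitz (block A h) l, block_succ_submatrix, newCoeff]
  simp only [RingOps.ofRing_sub, RingOps.ofRing_mul, RingOps.ofRing_zero, coeffList_getD]
  congr 1
  rw [coeffList, dot_ofFn_drop, ← Finset.Ico_add_one_add_one_eq_Ioc, Finset.sum_Ico_eq_sum_range]
  simp only [Nat.add_sub_add_right, Nat.add_sub_cancel_left]
  refine Finset.sum_congr rfl fun t ht => ?_
  rw [Finset.mem_range] at ht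
  rw [← coeffList, coeffList_getD, getD_ofFn, dif_pos (show t < r by omega), hqdef]

/-- **The fold runs through the leading blocks.** [cite: Berkowitz1984, §2] -/
theorem coeffStep_foldl_rows {r : ℕ} (h : r ≤ n) :
    (List.replicate r ()).foldl (coeffStep (RingOps.ofRing R) (rows A)) (0, [1]) = (r, coeffList A h) := by
  induction r with
  | zero =>
    simp only [List.replicate_zero, List.foldl_nil, Prod.mk.injEq, true_and]
    rw [coeffList, List.ofFn_succ, List.ofFn_zero]
    simp [block, Matrix.charpoly, Matrix.det_isEmpty]
  | succ r ih =>
    rw [List.replicate_succ', List.foldl_append, ih (Nat.le_of_succ_le h), List.foldl_cons,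
      List.foldl_nil, coeffStep]
    simp only [Prod.mk.injEq, true_and]
    exact step_coeffList A h

/-- **Correctness of Berkowitz's algorithm**: on the rows of an `n × n` matrix over a commutative
ring, `charpolyCoeffs` returns the coefficient list `[χ_A.coeff 0, …, χ_A.coeff n]`.
[cite: Berkowitz1984, §2] [cite: Soltys2002, §2 Def. 2] -/
theorem charpolyCoeffs_rows :
    charpolyCoeffs (RingOps.ofRing R) (rows A) = List.ofFn fun l : Fin (n + 1) => A.charpoly.coeff l := by
  rw [charpolyCoeffs, length_rows, show (RingOps.ofRing R).one = (1 : R) from rfl,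
    coeffStep_foldl_rows A le_rfl, coeffList]
  have hb : block A le_rfl = A := by ext i j; rfl
  rw [hb]

/-- **The determinant**: `det (ofRing R) (rows A) = A.det` (`det A = (-1)ⁿ χ_A(0)`,
Mathlib `Matrix.det_eq_sign_charpoly_coeff`). [cite: Berkowitz1984, §2] -/
theorem det_rows : det (RingOps.ofRing R) (rows A) = A.det := by
  rw [det, charpolyCoeffs_rows, length_rows, Matrix.det_eq_sign_charpoly_coeff, Fintype.card_fin,
    show (RingOps.ofRing R).zero = (0 : R) from rfl, getD_ofFn, dif_pos n.succ_pos]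
  simp only [RingOps.ofRing_sub]
  rcases Nat.even_or_odd n with hn | hn
  · rw [if_pos (Nat.even_iff.1 hn), hn.neg_one_pow, one_mul]
  · rw [if_neg (by rw [Nat.odd_iff.1 hn]; omega), hn.neg_one_pow]; ring

end Ring

/-! ### The integer determinant by arithmetic modulo `N + 1` -/

section Integer

/-- Reduce an integer modulo `N + 1` to its representative in `[0, N]`. [folklore] -/
def zmodNat (N : ℕ) (z : ℤ) : ℕ := (z % ((N : ℤ) + 1)).toNat

/-- The balanced residue: `x ↦ x` if `2x ≤ N`, else `x - (N + 1)`. [folklore] -/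
def balancedLift (N x : ℕ) : ℤ := if 2 * x ≤ N then (x : ℤ) else (x : ℤ) - (N + 1)

/-- **The integer determinant by modular arithmetic**: run Berkowitz's program with the machine
operations modulo `N + 1` on the reduced entries, then take the balanced residue.
[cite: Berkowitz1984, §2] -/
def intDet (N : ℕ) (A : List (List ℤ)) : ℤ := balancedLift N (det (RingOps.modSucc N) (A.map (·.map (zmodNat N))))

/-- The reduced representative has the right residue class. [folklore] -/
theorem cast_zmodNat (N : ℕ) (z : ℤ) : ((zmodNat N z : ℕ) : ZMod (N + 1)) = (z : ZMod (N + 1)) := by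
  rw [zmodNat]
  have h0 : (0 : ℤ) ≤ z % ((N : ℤ) + 1) := Int.emod_nonneg _ (by omega)
  have h1 : (((z % ((N : ℤ) + 1)).toNat : ℕ) : ℤ) = z % ((N : ℤ) + 1) := Int.toNat_of_nonneg h0
  rw [← Int.cast_natCast, h1, show ((N : ℤ) + 1) = ((N + 1 : ℕ) : ℤ) by push_cast; ring,
    ZMod.intCast_mod]

/-- Every coefficient produced by a step of the modular program is reduced. [folklore] -/
theorem step_modSucc_lt (N : ℕ) (A : List (List ℕ)) (c : List ℕ) (r : ℕ) :
    ∀ x ∈ step (RingOps.modSucc N) A c r, x < N + 1 := by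
  intro x hx
  rw [step, List.mem_map] at hx
  obtain ⟨l, -, rfl⟩ := hx
  exact RingOps.modSucc_sub_lt N _ _

/-- The modular determinant is a reduced representative. [folklore] -/
theorem det_modSucc_lt (N : ℕ) (A : List (List ℕ)) : det (RingOps.modSucc N) A < N + 1 := by
  have hc : ∀ x ∈ charpolyCoeffs (RingOps.modSucc N) A, x < N + 1 := by
    rw [charpolyCoeffs]
    generalize A.length = k
    suffices h : ∀ (k : ℕ) (p : ℕ × List ℕ), (∀ x ∈ p.2, x < N + 1) →
        ∀ x ∈ ((List.replicate k ()).foldl (coeffStep (RingOps.modSucc N) A) p).2, x < N + 1 from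
      h k (0, [(RingOps.modSucc N).one]) (by simpa using RingOps.modSucc_one_lt N)
    intro k
    induction k with
    | zero => intro p hp; simpa using hp
    | succ k ih =>
      intro p hp
      rw [List.replicate_succ, List.foldl_cons]
      exact ih _ (step_modSucc_lt N A p.2 p.1)
  have h0 : (charpolyCoeffs (RingOps.modSucc N) A).getD 0 0 < N + 1 := by
    rcases hl : charpolyCoeffs (RingOps.modSucc N) A with _ | ⟨x, l⟩
    · simp
    · rw [List.getD_cons_zero]; exact hc x (by rw [hl]; exact List.mem_cons_self)
  rw [det]
  split_ifs
  · exact h0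
  · exact RingOps.modSucc_sub_lt N _ _

/-- The balanced residue recovers a small integer from its residue. [folklore] -/
theorem balancedLift_eq {N x : ℕ} {d : ℤ} (hx : x < N + 1) (hd : 2 * |d| ≤ N)
    (h : (x : ZMod (N + 1)) = (d : ZMod (N + 1))) : balancedLift N x = d := by
  rw [← Int.cast_natCast, ZMod.intCast_eq_intCast_iff, Int.modEq_iff_dvd] at h
  obtain ⟨k, hk⟩ := h
  push_cast at hk
  obtain ⟨hlo, hhi⟩ := abs_le.1 (show |2 * d| ≤ N by rwa [abs_mul, abs_two])
  have hx' : (x : ℤ) < N + 1 := by exact_mod_cast hx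
  have hN0 : (0 : ℤ) ≤ N + 1 := by positivity
  rw [balancedLift]
  split_ifs with h2
  · have h2' : (2 * x : ℤ) ≤ N := by exact_mod_cast h2
    rcases lt_trichotomy k 0 with hk0 | hk0 | hk0
    · have := mul_nonneg (show (0 : ℤ) ≤ -1 - k by omega) hN0
      nlinarith
    · subst hk0; linarith
    · have := mul_nonneg (show (0 : ℤ) ≤ k - 1 by omega) hN0
      nlinarith
  · have h2' : (N : ℤ) < 2 * x := by exact_mod_cast not_le.1 h2
    rcases lt_trichotomy k (-1) with hk0 | hk0 | hk0
    · have := mul_nonneg (show (0 : ℤ) ≤ -2 - k by omega) hN0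
      nlinarith
    · subst hk0; linarith
    · have := mul_nonneg (show (0 : ℤ) ≤ k by omega) hN0
      nlinarith

/-- **The modular route to the integer determinant is exact**: for an `n × n` integer matrix with
entries bounded by `T` in absolute value and `2 · n! · Tⁿ ≤ N`, `intDet N (rows A) = A.det`
(functoriality `map_det` to `ZMod (N + 1)`, correctness `det_rows` there, `RingHom.map_det`, and
the Hadamard-type bound `Matrix.det_le`). [cite: Berkowitz1984, §2] -/
theorem intDet_rows {n : ℕ} (A : Matrix (Fin n) (Fin n) ℤ) {N T : ℕ} (hT : ∀ i j, |A i j| ≤ T)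
    (hN : 2 * (Nat.factorial n * T ^ n) ≤ N) : intDet N (rows A) = A.det := by
  rw [intDet]
  have hhom := RingOps.isHom_modSucc N
  -- the modular run is the image of the run over `ZMod (N+1)` on the reduced matrix
  have hcast : ((det (RingOps.modSucc N) ((rows A).map (·.map (zmodNat N))) : ℕ) : ZMod (N + 1)) =
      (A.det : ZMod (N + 1)) := by
    rw [map_det hhom]
    have hrows : ((rows A).map (·.map (zmodNat N))).map (·.map (fun a : ℕ => (a : ZMod (N + 1)))) =
        rows (A.map (Int.castRingHom (ZMod (N + 1)))) := by
      simp only [rows, List.map_ofFn]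
      congr 1
      funext i
      simp only [Function.comp_apply, List.map_ofFn]
      congr 1
      funext j
      simp [cast_zmodNat]
    rw [hrows, det_rows, ← RingHom.mapMatrix_apply, ← RingHom.map_det, eq_intCast]
  have hdet : |A.det| ≤ (Nat.factorial n * T ^ n : ℕ) := by
    have h := Matrix.det_le (A := A) (abv := AbsoluteValue.abs) (x := (T : ℤ)) (fun i j => hT i j)
    simpa [Fintype.card_fin, nsmul_eq_mul] using h
  exact balancedLift_eq (det_modSucc_lt N _) (by omega) hcast

end Integer

end Berkowitz

end Literature.LinearAlgebra.Matrix
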